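/-
Copyright (c) 2026 the pub-hodgecm-mathlib formalisation cell (harness21).  Prover seat hodgecm-mathlib-K2E1-p08 (g4), Track B ∕ K2-LIT, h413 =
`stmt-HodgeConjecture-24833`, line `K2_E1_TraceFormulaBeta`, campaign «EIS-RANK-ONE» rung R2 «Godement»; DEAL «EIS-U3-GODEMENT» of the dealer K2E1-plan (g3)
2026-09-04T04:19:39Z ∕ ruling R-EIS-1, file (G0): GODEMENT'S COUNT, GENERIC (carrier-free twin of the K2Liu organs ★ `K2LiuSiegelDoubledCountVsIntegral`,
★ `K2LiuSiegelDoubledCountReduction` §2–3, ★ `K2LiuSiegelDoubledUnfold`).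
-/
import Literature.MeasureTheory.Group.CoveringWeights      -- ★ covering weights: `coveringSum`, `IsCoveringWeight`, exchange identity, unfolding to a subgroup
import Mathlib.MeasureTheory.Group.Measure
import Mathlib.Topology.Algebra.Group.Pointwise
import Mathlib.Data.Set.Card
import Mathlib.Data.Real.ENatENNReal
import HarnessLib

/-!
# K2·E1 — `K2E1GodementCount`: GODEMENT'S COUNT, GENERIC — `Σ_{γ ∈ Γ'∖Γ} ψ(γ g) ≤ (A·m ∕ μ(C)) · ∫_{Γ'∖G} ψ`

Track B ∕ K2-LIT, crux h413 = `stmt-HodgeConjecture-24833`, route of record `HCCMUnconditional`; cell `hodgecm-mathlib`, squad K2, ENGINE E1, campaign «EIS-RANK-ONE»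
rung R2 (absolute convergence of Borel Eisenstein series, Godement's criterion).  Prover seat `hodgecm-mathlib-K2E1-p08` (g4); DEAL «EIS-U3-GODEMENT» (K2E1-plan (g3)
04:19:39Z, ruling R-EIS-1 04:25:41Z), file (G0).  THEOREMS ONLY (no `def`, no `instance`, no notation, no named-fact hypothesis, no `sorry`); lane `--kind proof
--supports stmt-HodgeConjecture-24833 --as helper` (count-neutral).

THE ENGINE, CARRIER-FREE.  The organs E2 («count ≤ integral»), E3a («bounded multiplicity»), E3b («unfold») of Godement's proof of the absolute convergence of
Eisenstein series ([Godement1964, §8]; [Garrett2018, §3.10, proof of Cor. 3.10.2]; [MoeglinWaldspurger1995, II.1.5]) are typed in the tree for the doubled unitary group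
`HA` (★ K2Liu #9 organs).  Here they are stated ONCE for: a group `G` with a left-invariant measure `μ`, subgroups `Γ' ≤ Γ ≤ G` (`Γ` countable — the rational
points; `Γ'` — the rational parabolic), an arbitrary countable index type `ι` with representatives `s : ι → G`, `s i ∈ Γ`, of the cosets `Γ'∖Γ` (`∀ γ ∈ Γ, ∃! i,
γ (s i)⁻¹ ∈ Γ'` — e.g. ruling R-EIS-1's `q ↦ toAdelic (q.out : ↥U(F))` on ★ p857160's `Quotient (orbitRel ↥B(F) ↥U(F))`), and functions `ψ₁, ψ₂ : G → [0,∞]` with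
the SMEAR `ψ₁(y) ≤ A·ψ₂(y c)` for `c` in a measurable `C` — no topology except for the finiteness of the multiplicity (§3).

* §1 **E2** `mul_measure_le_mul_setLIntegral` (`ψ₁(y)·μ(C) ≤ A ∫⁻_C ψ₂(y c) dμ(c)`), **`tsum_mul_measure_le_mul_lintegral_indicator_tsum`**:
  `(Σ'_i ψ₁(s_i g))·μ(C) ≤ A · ∫⁻ 𝟙_{g•C}(y) · Σ'_i ψ₂(s_i y) dμ(y)` (Tonelli, left invariance `∫⁻_C Φ(g c) = ∫⁻_{gC} Φ`).
* §2 **E3a** `lintegral_indicator_mul_le_of_coveringSum_le`: for `Φ ≥ 0` measurable left-`Γ`-invariant, a `Γ`-covering weight `β` and a measurable `S` met by every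
  orbit at most `m` times (`Σ_{γ∈Γ} 𝟙_S(γ y) ≤ m`):  `∫⁻ 𝟙_S Φ dμ ≤ m ∫⁻ Φ β dμ` (★ exchange identity `lintegral_mul_mul_coveringSum_comm`).
* §3 THE MULTIPLICITY: `coveringSum_indicator_le_ncard` (`Σ_γ 𝟙_S(γ y) ≤ #(Γ ∩ S S⁻¹)` when finite), `finite_coe_inter_of_isCompact` (a discrete subgroup of a
  Hausdorff topological group meets a compact set in a finite set), `exists_nat_forall_coveringSum_indicator_le` (for `S` compact: a uniform `m ∈ ℕ`).
* §4 **THE ENGINE** `translateSum_invariant` (`y ↦ Σ'_i ψ(s_i y)` is left-`Γ`-invariant for left-`Γ'`-invariant `ψ`: re-indexing the cosets), **`tsum_le_mul_lintegral_weight`**: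
  `Σ'_i ψ₁(s_i g) ≤ (A·m ∕ μ C) · ∫⁻ ψ₂ β' dμ` for a `Γ'`-weight `β'` and a `Γ`-weight `β` (E2 + E3a + ★ E3b `lintegral_mul_eq_lintegral_tsum_mul`), and the real-valued
  corollary **`summable_toReal_of_lintegral_weight_ne_top`**.  The analytic input left to the consumer is the single number `∫⁻ ψ₂ β' dμ < ∞` — the integral of `ψ₂`
  over «`Γ'∖G`» (for Eisenstein series: `ψ₂ = H^τ·𝟙_{H ≤ C₀}`, Godement's parabolic ∕ Siegel-domain integral, files (G2)(G3) of the deal).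
HONEST LABEL: HC_CM is proved only modulo the 7 printed citations (2 remaining named inputs: hLiu418 = `stmt-HodgeConjecture-24832`, h413 = `stmt-HodgeConjecture-24833`) until rung 0
closes; generic helper, proves no printed statement, closes no socket.
References: [Godement1964] R. Godement, *Domaines fondamentaux des groupes arithmétiques*, Sém. Bourbaki 257, §8 · [Garrett2018] P. Garrett, *Modern Analysis of Automorphic Forms
by Example* (2018), §3.10 (proof of Cor. 3.10.2), §1.8 · [MoeglinWaldspurger1995] C. Mœglin, J.-L. Waldspurger, *Spectral Decomposition and Eisenstein Series* (1995), II.1.5 ·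
[CogdellAnalyticTheory2004] J. W. Cogdell, *Analytic theory of L-functions for GL_n* (2004), §2.3.
-/

set_option autoImplicit false
-- the mandated namespace repeats the single-problem summit's segment (`HodgeConjecture.HodgeConjecture`)
set_option linter.dupNamespace false

noncomputable section

open MeasureTheory MeasureTheory.Measure Set Filter Topology
open scoped ENNReal NNReal Pointwise
open Literature.MeasureTheory.Group

namespace Summit.HodgeConjecture.HodgeConjecture.Cruxes.H413.K2E1GodementCount

/-! ## §1 E2 «count ≤ integral» -/

section E2

variable {G : Type*} [Group G] [MeasurableSpace G] [MeasurableMul G] (μ : Measure G) [μ.IsMulLeftInvariant]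

omit [μ.IsMulLeftInvariant] in
/-- **E2, one point**: if `ψ₁(y) ≤ A·ψ₂(y c)` for all `c ∈ C` then `ψ₁(y) · μ(C) ≤ A · ∫⁻_{c ∈ C} ψ₂(y c) dμ`. [cite: Garrett2018, §3.10 (proof of Cor. 3.10.2)] -/
theorem mul_measure_le_mul_setLIntegral {ψ₁ ψ₂ : G → ℝ≥0∞} (hψ₂ : Measurable ψ₂) {C : Set G} (hC : MeasurableSet C) {A : ℝ≥0∞}
    (hsm : ∀ y : G, ∀ c ∈ C, ψ₁ y ≤ A * ψ₂ (y * c)) (y : G) :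
    ψ₁ y * μ C ≤ A * ∫⁻ c in C, ψ₂ (y * c) ∂μ := by
  calc ψ₁ y * μ C = ∫⁻ _ in C, ψ₁ y ∂μ := (setLIntegral_const C (ψ₁ y)).symm
    _ ≤ ∫⁻ c in C, A * ψ₂ (y * c) ∂μ := setLIntegral_mono' hC fun c hc => hsm y c hc
    _ = A * ∫⁻ c in C, ψ₂ (y * c) ∂μ := lintegral_const_mul A (hψ₂.comp (measurable_const_mul y))

/-- Left invariance on a translate: `∫⁻_{c ∈ C} Φ(g c) dμ = ∫⁻ 𝟙_{g•C} Φ dμ`. [folklore] -/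
theorem setLIntegral_comp_mul_left_eq (Φ : G → ℝ≥0∞) {C : Set G} (hC : MeasurableSet C) (g : G) :
    ∫⁻ c in C, Φ (g * c) ∂μ = ∫⁻ y, (g • C).indicator Φ y ∂μ := by
  rw [← lintegral_indicator hC, ← lintegral_mul_left_eq_self (fun y => (g • C).indicator Φ y) g]
  refine lintegral_congr fun c => ?_
  by_cases hc : c ∈ C
  · rw [indicator_of_mem hc, indicator_of_mem (show g * c ∈ g • C from smul_mem_smul_set_iff.2 hc)]
  · rw [indicator_of_notMem hc, indicator_of_notMem (show g * c ∉ g • C from fun h => hc (smul_mem_smul_set_iff.1 h))]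

/-- **E2 «COUNT ≤ INTEGRAL»**: for a countable family of translates `s_i g` and the smear `ψ₁(y) ≤ A ψ₂(y c)` (`c ∈ C` measurable):
`(Σ'_i ψ₁(s_i g)) · μ(C) ≤ A · ∫⁻ 𝟙_{g•C}(y) Σ'_i ψ₂(s_i y) dμ(y)`. [cite: Garrett2018, §3.10 (proof of Cor. 3.10.2)] [cite: MoeglinWaldspurger1995, II.1.5] -/
theorem tsum_mul_measure_le_mul_lintegral_indicator_tsum {ι : Type*} [Countable ι] (s : ι → G) {ψ₁ ψ₂ : G → ℝ≥0∞} (hψ₂ : Measurable ψ₂)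
    {C : Set G} (hC : MeasurableSet C) {A : ℝ≥0∞} (hsm : ∀ y : G, ∀ c ∈ C, ψ₁ y ≤ A * ψ₂ (y * c)) (g : G) :
    (∑' i, ψ₁ (s i * g)) * μ C ≤ A * ∫⁻ y, (g • C).indicator (fun y => ∑' i, ψ₂ (s i * y)) y ∂μ := by
  have hmi : ∀ i, Measurable fun c => ψ₂ (s i * (g * c)) := fun i => hψ₂.comp ((measurable_const_mul (s i)).comp (measurable_const_mul g))
  rw [← setLIntegral_comp_mul_left_eq μ _ hC g, ← ENNReal.tsum_mul_right]
  calc ∑' i, ψ₁ (s i * g) * μ C ≤ ∑' i, A * ∫⁻ c in C, ψ₂ (s i * g * c) ∂μ :=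
        ENNReal.tsum_le_tsum fun i => mul_measure_le_mul_setLIntegral μ hψ₂ hC hsm (s i * g)
    _ = A * ∑' i, ∫⁻ c in C, ψ₂ (s i * (g * c)) ∂μ := by
        rw [ENNReal.tsum_mul_left]
        simp only [mul_assoc]
    _ = A * ∫⁻ c in C, ∑' i, ψ₂ (s i * (g * c)) ∂μ := by
        congr 1
        exact (lintegral_tsum fun i => (hmi i).aemeasurable).symm

end E2

/-! ## §2 E3a «bounded multiplicity» -/

section E3a

variable {G : Type*} [Group G] [MeasurableSpace G] [MeasurableMul G] (μ : Measure G) [μ.IsMulLeftInvariant] (Γ : Subgroup G) [Countable Γ]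

/-- **E3a «BOUNDED MULTIPLICITY»**: `Φ ≥ 0` measurable and left-`Γ`-invariant, `β` a `Γ`-covering weight, `S` measurable with `Σ_{γ ∈ Γ} 𝟙_S(γ y) ≤ m` for all `y`; then
`∫⁻ 𝟙_S Φ dμ ≤ m · ∫⁻ Φ β dμ` — insert `1 = Σ_γ β(γ y)` and exchange (★ `lintegral_mul_mul_coveringSum_comm`). [cite: Garrett2018, §3.10 (proof of Cor. 3.10.2)]
[cite: MoeglinWaldspurger1995, II.1.5] -/
theorem lintegral_indicator_mul_le_of_coveringSum_le {Φ : G → ℝ≥0∞} (hΦ : Measurable Φ) (hΦinv : ∀ γ ∈ Γ, ∀ y : G, Φ (γ * y) = Φ y)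
    {β : G → ℝ≥0∞} (hβ : IsCoveringWeight Γ β) {S : Set G} (hS : MeasurableSet S) {m : ℝ≥0∞} (hm : ∀ y : G, coveringSum Γ (S.indicator 1) y ≤ m) :
    ∫⁻ y, S.indicator Φ y ∂μ ≤ m * ∫⁻ y, Φ y * β y ∂μ := by
  haveI : MeasurableConstSMul Γ G := ⟨fun γ => measurable_const_mul (γ : G)⟩
  have hΦinv' : ∀ (γ : Γ) (y : G), Φ (γ • y) = Φ y := fun γ y => hΦinv γ γ.2 y
  have hex := lintegral_mul_mul_coveringSum_comm (Γ := Γ) μ hΦ hΦinv' (measurable_one.indicator hS) hβ.1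
  -- `∫ Φ 𝟙_S (Σ β) = ∫ Φ β (Σ 𝟙_S)`, and `Σ β = 1`
  have hL : ∫⁻ y, S.indicator Φ y ∂μ = ∫⁻ y, Φ y * S.indicator 1 y * coveringSum Γ β y ∂μ := by
    refine lintegral_congr fun y => ?_
    rw [hβ.2 y, mul_one]
    by_cases hy : y ∈ S
    · rw [indicator_of_mem hy, indicator_of_mem hy, Pi.one_apply, mul_one]
    · rw [indicator_of_notMem hy, indicator_of_notMem hy, mul_zero]
  rw [hL, hex]
  have hmeas : Measurable fun y => Φ y * β y := hΦ.mul hβ.1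
  calc ∫⁻ y, Φ y * β y * coveringSum Γ (S.indicator 1) y ∂μ ≤ ∫⁻ y, Φ y * β y * m ∂μ := lintegral_mono fun y => mul_le_mul_right (hm y) _
    _ = m * ∫⁻ y, Φ y * β y ∂μ := by
        rw [← lintegral_const_mul m hmeas]
        exact lintegral_congr fun y => mul_comm _ _

end E3a

/-! ## §3 The multiplicity: a discrete subgroup meets a compact set finitely often -/

section Multiplicity

variable {G : Type*} [Group G] (Γ : Subgroup G)

/-- **`Σ_{γ ∈ Γ} 𝟙_S(γ y) ≤ #(Γ ∩ S·S⁻¹)`**: two elements `γ, γ₀ ∈ Γ` with `γ y, γ₀ y ∈ S` differ by `γ γ₀⁻¹ = (γ y)(γ₀ y)⁻¹ ∈ S S⁻¹`, so `γ ↦ γ γ₀⁻¹` maps `{γ : γ y ∈ S}`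
injectively into `Γ ∩ S S⁻¹` (if the latter is finite). [cite: Garrett2018, §1.8] [cite: MoeglinWaldspurger1995, II.1.5] -/
theorem coveringSum_indicator_le_ncard {S : Set G} (hfin : ((Γ : Set G) ∩ (S * S⁻¹)).Finite) (y : G) :
    coveringSum Γ (S.indicator (1 : G → ℝ≥0∞)) y ≤ (((Γ : Set G) ∩ (S * S⁻¹)).ncard : ℝ≥0∞) := by
  classical
  set A : Set Γ := {γ | (γ : G) * y ∈ S} with hA
  have hsum : coveringSum Γ (S.indicator (1 : G → ℝ≥0∞)) y = ∑' γ : Γ, A.indicator (fun _ => (1 : ℝ≥0∞)) γ := by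
    rw [coveringSum_apply]
    refine tsum_congr fun γ => ?_
    simp only [Set.indicator_apply, hA, Set.mem_setOf_eq, Subgroup.smul_def, smul_eq_mul, Pi.one_apply]
  rw [hsum, ← tsum_subtype A (fun _ => (1 : ℝ≥0∞)), ENNReal.tsum_set_one]
  by_cases hAe : A = ∅
  · rw [hAe, Set.encard_empty]
    simp
  obtain ⟨γ₀, hγ₀⟩ := Set.nonempty_iff_ne_empty.2 hAe
  -- `γ ↦ γ γ₀⁻¹` : `A ↪ Γ ∩ S S⁻¹`
  have hinj : Set.InjOn (fun γ : Γ => (γ : G) * (γ₀ : G)⁻¹) A := fun a _ b _ h => Subtype.ext (mul_right_cancel h)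
  have hmaps : Set.MapsTo (fun γ : Γ => (γ : G) * (γ₀ : G)⁻¹) A ((Γ : Set G) ∩ (S * S⁻¹)) := by
    intro γ hγ
    refine ⟨Γ.mul_mem γ.2 (Γ.inv_mem γ₀.2), ?_⟩
    refine ⟨(γ : G) * y, hγ, ((γ₀ : G) * y)⁻¹, Set.inv_mem_inv.2 hγ₀, ?_⟩
    change (γ : G) * y * ((γ₀ : G) * y)⁻¹ = (γ : G) * (γ₀ : G)⁻¹
    rw [mul_inv_rev, ← mul_assoc, mul_inv_cancel_right]
  have hAfin : A.Finite := Set.Finite.of_injOn hmaps hinj hfin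
  rw [← hAfin.cast_ncard_eq]
  exact_mod_cast Set.ncard_le_ncard_of_injOn _ hmaps hinj hfin

variable [TopologicalSpace G] [IsTopologicalGroup G] [T2Space G] [DiscreteTopology Γ]

/-- **A discrete subgroup of a Hausdorff topological group meets a compact set in a finite set** (Mathlib `Subgroup.tendsto_coe_cofinite_of_discrete`).
[cite: Garrett2018, §1.8] -/
theorem finite_coe_inter_of_isCompact {D : Set G} (hD : IsCompact D) : ((Γ : Set G) ∩ D).Finite := by
  have h := Subgroup.tendsto_coe_cofinite_of_discrete Γ (isDiscrete_iff_discreteTopology.mpr ‹DiscreteTopology Γ›) hD.compl_mem_cocompact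
  rw [Filter.mem_map, Filter.mem_cofinite, Set.preimage_compl, compl_compl] at h
  have himg : (Γ : Set G) ∩ D = ((↑) : Γ → G) '' (((↑) : Γ → G) ⁻¹' D) := by
    ext x
    constructor
    · rintro ⟨hx, hxD⟩
      exact ⟨⟨x, hx⟩, hxD, rfl⟩
    · rintro ⟨γ, hγ, rfl⟩
      exact ⟨γ.2, hγ⟩
  rw [himg]
  exact h.image _

/-- **UNIFORM MULTIPLICITY**: for `S` compact there is `m ∈ ℕ` with `Σ_{γ ∈ Γ} 𝟙_S(γ y) ≤ m` for EVERY `y` (`m = #(Γ ∩ S S⁻¹)`, `S S⁻¹` compact).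
[cite: Garrett2018, §1.8] [cite: MoeglinWaldspurger1995, II.1.5] -/
theorem exists_nat_forall_coveringSum_indicator_le {S : Set G} (hS : IsCompact S) :
    ∃ m : ℕ, ∀ y : G, coveringSum Γ (S.indicator (1 : G → ℝ≥0∞)) y ≤ m :=
  ⟨_, coveringSum_indicator_le_ncard Γ (finite_coe_inter_of_isCompact Γ (hS.mul hS.inv))⟩

end Multiplicity

/-! ## §4 The engine: `Σ'_i ψ₁(s_i g) ≤ (A·m ∕ μ C) · ∫⁻ ψ₂ β' dμ` -/

section Engine

variable {G : Type*} [Group G] [MeasurableSpace G] [MeasurableMul G] (μ : Measure G) [μ.IsMulLeftInvariant]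
  (Γ Γ' : Subgroup G) [Countable Γ] (hle : Γ' ≤ Γ)
  {ι : Type*} [Countable ι] {s : ι → G} (hsΓ : ∀ i, s i ∈ Γ) (hs : ∀ γ ∈ Γ, ∃! i, γ * (s i)⁻¹ ∈ Γ')

omit [MeasurableSpace G] [MeasurableMul G] [Countable Γ] [Countable ι] in
include hsΓ hs in
/-- **Re-indexing**: for `ψ` left-`Γ'`-invariant, `y ↦ Σ'_i ψ(s_i y)` is left-`Γ`-invariant — right multiplication by `γ ∈ Γ` permutes the cosets `Γ'∖Γ`: `i ↦ j(i)` with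
`s_i γ (s_j)⁻¹ ∈ Γ'`, a bijection of `ι` (inverse via `γ⁻¹`), and `ψ(s_i γ y) = ψ(s_{j(i)} y)`. [cite: Garrett2018, §3.10] -/
theorem translateSum_invariant {M : Type*} [AddCommMonoid M] [TopologicalSpace M] {ψ : G → M} (hψ : ∀ γ ∈ Γ', ∀ y : G, ψ (γ * y) = ψ y) :
    ∀ γ ∈ Γ, ∀ y : G, (∑' i, ψ (s i * (γ * y))) = ∑' i, ψ (s i * y) := by
  intro γ hγ y
  classical
  -- the permutation `j` of `ι` induced by right multiplication by `γ`, and its inverse induced by `γ⁻¹`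
  have hj : ∀ i, ∃! j, s i * γ * (s j)⁻¹ ∈ Γ' := fun i => hs _ (Γ.mul_mem (hsΓ i) hγ)
  have hk : ∀ j, ∃! k, s j * γ⁻¹ * (s k)⁻¹ ∈ Γ' := fun j => hs _ (Γ.mul_mem (hsΓ j) (Γ.inv_mem hγ))
  choose j hjmem hjuniq using hj
  choose k hkmem hkuniq using hk
  have hkj : ∀ i, k (j i) = i := fun i => by
    -- `s_{j i} γ⁻¹ s_i⁻¹ = (s_i γ s_{j i}⁻¹)⁻¹ ∈ Γ'`
    have h := Γ'.inv_mem (hjmem i)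
    rw [mul_inv_rev, mul_inv_rev, inv_inv, ← mul_assoc] at h
    exact (hkuniq (j i) i h).symm
  have hjk : ∀ i, j (k i) = i := fun i => by
    have h := Γ'.inv_mem (hkmem i)
    rw [mul_inv_rev, mul_inv_rev, inv_inv, inv_inv, ← mul_assoc] at h
    exact (hjuniq (k i) i h).symm
  let e : ι ≃ ι := ⟨j, k, hkj, hjk⟩
  -- termwise: `ψ(s_i γ y) = ψ(s_{j i} y)` since `s_i γ = γ' s_{j i}` with `γ' ∈ Γ'`
  have hterm : ∀ i, ψ (s i * (γ * y)) = ψ (s (e i) * y) := fun i => by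
    have h := hψ _ (hjmem i) (s (j i) * y)
    rw [← mul_assoc, inv_mul_cancel_right] at h
    rw [← mul_assoc]
    exact h
  calc (∑' i, ψ (s i * (γ * y))) = ∑' i, ψ (s (e i) * y) := tsum_congr hterm
    _ = ∑' i, ψ (s i * y) := e.tsum_eq (fun i => ψ (s i * y))

include hle hsΓ hs in
/-- **THE ENGINE — GODEMENT'S COUNT.**  `μ` left-invariant, `Γ' ≤ Γ ≤ G` with `Γ` countable, `s : ι → Γ` representatives of `Γ'∖Γ`; `ψ₂ ≥ 0` measurable left-`Γ'`-invariant,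
`ψ₁ ≤ A·ψ₂(· c)` for `c ∈ C` (measurable); `β` a `Γ`-weight, `β'` a `Γ'`-weight; `Σ_{γ∈Γ} 𝟙_{g•C}(γ y) ≤ m` for all `y`.  THEN
**`(Σ'_i ψ₁(s_i g)) · μ(C) ≤ A · m · ∫⁻ ψ₂ β' dμ`** — E2 (§1), E3a (§2) for the left-`Γ`-invariant `Φ = Σ'_i ψ₂(s_i ·)` (`translateSum_invariant`), E3b ★
`lintegral_mul_eq_lintegral_tsum_mul` (`∫⁻ Φ β = ∫⁻ ψ₂ β'`). [cite: Godement1964, §8] [cite: Garrett2018, §3.10 (proof of Cor. 3.10.2)] [cite: MoeglinWaldspurger1995, II.1.5] -/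
theorem tsum_mul_measure_le_mul_lintegral_weight {ψ₁ ψ₂ : G → ℝ≥0∞} (hψ₂ : Measurable ψ₂) (hψ₂inv : ∀ γ ∈ Γ', ∀ y : G, ψ₂ (γ * y) = ψ₂ y)
    {C : Set G} (hC : MeasurableSet C) {A : ℝ≥0∞} (hsm : ∀ y : G, ∀ c ∈ C, ψ₁ y ≤ A * ψ₂ (y * c))
    {β β' : G → ℝ≥0∞} (hβ : IsCoveringWeight Γ β) (hβ' : IsCoveringWeight Γ' β') (g : G) {m : ℝ≥0∞}
    (hm : ∀ y : G, coveringSum Γ ((g • C).indicator 1) y ≤ m) :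
    (∑' i, ψ₁ (s i * g)) * μ C ≤ A * m * ∫⁻ y, ψ₂ y * β' y ∂μ := by
  haveI : MeasurableConstSMul G G := ⟨fun g => measurable_const_mul g⟩
  haveI : Countable Γ' := (Subgroup.inclusion_injective hle).countable
  have hΦ : Measurable fun y => ∑' i, ψ₂ (s i * y) := Measurable.tsum fun i => hψ₂.comp (measurable_const_mul (s i))
  have hΦinv := translateSum_invariant Γ Γ' hsΓ hs (ψ := ψ₂) hψ₂inv
  -- E3b: `∫⁻ Φ β = ∫⁻ ψ₂ β'`
  have hunfold : ∫⁻ y, ψ₂ y * β' y ∂μ = ∫⁻ y, (∑' i, ψ₂ (s i • y)) * β y ∂μ :=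
    lintegral_mul_eq_lintegral_tsum_mul μ Γ Γ' hle hψ₂ hψ₂inv hβ'.1 hβ'.2 hβ.1 hβ.2 hsΓ hs
  calc (∑' i, ψ₁ (s i * g)) * μ C ≤ A * ∫⁻ y, (g • C).indicator (fun y => ∑' i, ψ₂ (s i * y)) y ∂μ :=
        tsum_mul_measure_le_mul_lintegral_indicator_tsum μ s hψ₂ hC hsm g
    _ ≤ A * (m * ∫⁻ y, (∑' i, ψ₂ (s i * y)) * β y ∂μ) :=
        mul_le_mul_right (lintegral_indicator_mul_le_of_coveringSum_le μ Γ hΦ hΦinv hβ (hC.const_smul g) hm) A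
    _ = A * m * ∫⁻ y, ψ₂ y * β' y ∂μ := by
        rw [hunfold, mul_assoc]
        rfl

include hle hsΓ hs in
/-- **THE ENGINE, SOLVED FOR THE SUM**: with `0 < μ(C) < ∞`, `Σ'_i ψ₁(s_i g) ≤ (A · m ∕ μ C) · ∫⁻ ψ₂ β' dμ`. [cite: Godement1964, §8] [cite: Garrett2018, §3.10 (proof of Cor. 3.10.2)] -/
theorem tsum_le_mul_lintegral_weight {ψ₁ ψ₂ : G → ℝ≥0∞} (hψ₂ : Measurable ψ₂) (hψ₂inv : ∀ γ ∈ Γ', ∀ y : G, ψ₂ (γ * y) = ψ₂ y)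
    {C : Set G} (hC : MeasurableSet C) (hC₀ : μ C ≠ 0) (hCtop : μ C ≠ ∞) {A : ℝ≥0∞} (hsm : ∀ y : G, ∀ c ∈ C, ψ₁ y ≤ A * ψ₂ (y * c))
    {β β' : G → ℝ≥0∞} (hβ : IsCoveringWeight Γ β) (hβ' : IsCoveringWeight Γ' β') (g : G) {m : ℝ≥0∞}
    (hm : ∀ y : G, coveringSum Γ ((g • C).indicator 1) y ≤ m) :
    (∑' i, ψ₁ (s i * g)) ≤ A * m / μ C * ∫⁻ y, ψ₂ y * β' y ∂μ := by
  have h := tsum_mul_measure_le_mul_lintegral_weight μ Γ Γ' hle hsΓ hs hψ₂ hψ₂inv hC hsm hβ hβ' g hm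
  calc (∑' i, ψ₁ (s i * g)) = (∑' i, ψ₁ (s i * g)) * μ C / μ C := (ENNReal.mul_div_cancel_right hC₀ hCtop).symm
    _ ≤ A * m * (∫⁻ y, ψ₂ y * β' y ∂μ) / μ C := ENNReal.div_le_div_right h _
    _ = A * m / μ C * ∫⁻ y, ψ₂ y * β' y ∂μ := by
        rw [ENNReal.mul_div_right_comm]

include hle hsΓ hs in
/-- **SUMMABILITY.**  In the situation of `tsum_le_mul_lintegral_weight` with `A < ∞` and `∫⁻ ψ₂ β' dμ < ∞`: the real family `i ↦ (ψ₁(s_i g)).toReal` is summable (when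
`ψ₁ < ∞` pointwise), with sum `≤ ((A·m ∕ μ C) ∫⁻ ψ₂ β').toReal`. [cite: Godement1964, §8] [cite: MoeglinWaldspurger1995, II.1.5] -/
theorem summable_toReal_of_lintegral_weight_ne_top {ψ₁ ψ₂ : G → ℝ≥0∞} (hψ₁ : ∀ y, ψ₁ y ≠ ∞) (hψ₂ : Measurable ψ₂)
    (hψ₂inv : ∀ γ ∈ Γ', ∀ y : G, ψ₂ (γ * y) = ψ₂ y) {C : Set G} (hC : MeasurableSet C) (hC₀ : μ C ≠ 0) (hCtop : μ C ≠ ∞) {A : ℝ≥0∞} (hA : A ≠ ∞)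
    (hsm : ∀ y : G, ∀ c ∈ C, ψ₁ y ≤ A * ψ₂ (y * c)) {β β' : G → ℝ≥0∞} (hβ : IsCoveringWeight Γ β) (hβ' : IsCoveringWeight Γ' β')
    (hI : ∫⁻ y, ψ₂ y * β' y ∂μ ≠ ∞) (g : G) {m : ℕ} (hm : ∀ y : G, coveringSum Γ ((g • C).indicator 1) y ≤ m) :
    Summable (fun i => (ψ₁ (s i * g)).toReal) ∧
      ∑' i, (ψ₁ (s i * g)).toReal ≤ (A * m / μ C * ∫⁻ y, ψ₂ y * β' y ∂μ).toReal := by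
  have hle' := tsum_le_mul_lintegral_weight μ Γ Γ' hle hsΓ hs hψ₂ hψ₂inv hC hC₀ hCtop hsm hβ hβ' g (m := m) hm
  have hfin : A * m / μ C * ∫⁻ y, ψ₂ y * β' y ∂μ ≠ ∞ :=
    ENNReal.mul_ne_top (ENNReal.div_ne_top (ENNReal.mul_ne_top hA (ENNReal.natCast_ne_top m)) hC₀) hI
  have htsum : ∑' i, ψ₁ (s i * g) ≠ ∞ := ne_top_of_le_ne_top hfin hle'
  refine ⟨ENNReal.summable_toReal htsum, ?_⟩
  rw [← ENNReal.tsum_toReal_eq fun i => hψ₁ _]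
  exact ENNReal.toReal_mono hfin hle'

end Engine

end Summit.HodgeConjecture.HodgeConjecture.Cruxes.H413.K2E1GodementCount

end
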